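import Summits.QuantumFields.YangMills.Theorems.BalabanLadderNTWeakPackageNestedCovariance
import HarnessLib

/-!
# Crux `NT` (stmt-QuantumFields-19353), stub `stub_cfpw : CFPW`: nested law of total cumulance and the three-point collar

Helper file (`--supports stmt-QuantumFields-19353`) of the fleet lead prover of crux `NT` (unit `ym-spine-19353-p1`,
g3); the third-order twin of `…NTWeakPackageNestedCovariance`, tools for the companion file
`…NTWeakPackageCoverThreePoint` (the weak signed third-cumulant clause (T) of the registered stub `stub_cfpw : CFPW`,
skeleton v3 «weak-package» 374f16092bb0c203, on a covering set of radii):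

* `kerK3_lower_of_nested` — **law of total cumulance through a nested sub-cube, as a signed floor**: for cubes
  `Q₀ ⊆ Q`, sites `x, y, z`, a sign `σ = ±1`: if for EVERY exterior `ζ` the `Q₀`-conditional third cumulant has
  `σ · kerK3_{Q₀,ζ}(x,y,z) ≥ fl`, the three `Q₀`-kernel means of `dens` are within `h₀` of a constant and the three
  `Q₀`-conditional covariances are at most `cc` in absolute value, then `σ · kerK3_{Q,η}(x,y,z) ≥ fl − 6 h₀ cc − 8 h₀³`
  for every exterior `η` of `Q` (DLR consistency `BoundaryLaw.kerE_kerE_of_subset` ×7 + the tree's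
  `cumulant3_lower_of_kernel`; Georgii 2011 Def. 1.23 (iii));
* general-exponent collar lemmas (the two-point file has the exponent `8` hard-wired): `le_mul_one_add_collar_pow`
  (absorption: `B ≤ c Γs (1 + κ)^k` once `κ ≥ (max 0 (B/(c Γs)))^{1/k}`), `tendsto_mul_collar_rpow`
  (`s · (max 0 (A/Γ(s ∧ ℓ)))^{1/k} → 0` from the growth `Γ(s)/s^k → ∞`), `antitoneOn_collar_rpow`,
  `tendsto_div_pow_atTop_of_le` (growth at exponent `k` gives growth at every `m ≥ k`);
* triangle geometry `norm_bounds_of_near` (`‖a − n•u‖ ≤ t n` ⇒ `(‖u‖ − t) n ≤ ‖a‖ ≤ (‖u‖ + t) n`).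
-/

set_option autoImplicit false

noncomputable section

open MeasureTheory Filter Topology
open Literature.MathematicalPhysics.QuantumFieldTheory Literature.MathematicalPhysics.QuantumLattice
open Literature.Probability.LatticeModels
open Summit.QuantumFields.YangMills.Cruxes.OSLegsFromFemtoAndGap.DlrCollarTransfer
open Summit.QuantumFields.YangMills.Cruxes.OSLegsFromFemtoAndGap.DlrCollarTransfer.StubLower (exists_abs_dens_le)
open Summit.QuantumFields.YangMills.Theorems.OSLegsFromFemtoAndGap.StubLower (cumulant3_lower_of_kernel siteToE_sub)
open Summit.QuantumFields.YangMills.Cruxes.NT.BoundaryLaw (kerE_kerE_of_subset)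

namespace Summit.QuantumFields.YangMills.Cruxes.NT.WeakPackage

/-! ## §1 Law of total cumulance through a nested sub-cube, as a signed floor -/

section Kernel

variable (G : Type) [Group G] [TopologicalSpace G] [IsTopologicalGroup G] [CompactSpace G]
  [MeasurableSpace G] [BorelSpace G] (r : LatticeRep G)

/-- **Law of total cumulance through a nested sub-cube (signed floor form).**  For nested cubes `Q₀ ⊆ Q` (interior
links), sites `x, y, z`, a sign `σ = ±1` and every exterior `η` of `Q`: if for EVERY exterior `ζ` of `Q₀` the conditional
third cumulant satisfies `fl ≤ σ · kerK3_{Q₀,ζ}(x, y, z)`, the kernel means of the three action densities are within `h₀`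
of a common constant `p`, and the three conditional covariances are at most `cc` in absolute value, then
`fl − 6 h₀ cc − 8 h₀³ ≤ σ · kerK3_{Q,η}(x, y, z)`.  (Consistency makes the seven `Q`-kernel means entering `kerK3_Q` the
`γ_Q(·|η)`-means of the corresponding `Q₀`-kernel means; then the tree's `cumulant3_lower_of_kernel`.) [folklore] -/
theorem kerK3_lower_of_nested (β : ℝ) {c c₀ : Fin 4 → ℤ} {b b₀ : ℕ} (hsub : cubeEdges c₀ b₀ ⊆ cubeEdges c b)
    (η : LGConfig 4 G) (x y z : Fin 4 → ℤ) {p h₀ cc fl σ : ℝ} (hσ : σ = 1 ∨ σ = -1)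
    (hdx : ∀ ζ, |kerE G r β c₀ b₀ ζ (dens G r x) - p| ≤ h₀)
    (hdy : ∀ ζ, |kerE G r β c₀ b₀ ζ (dens G r y) - p| ≤ h₀)
    (hdz : ∀ ζ, |kerE G r β c₀ b₀ ζ (dens G r z) - p| ≤ h₀)
    (hcyz : ∀ ζ, |kerCov G r β c₀ b₀ ζ (dens G r y) (dens G r z)| ≤ cc)
    (hcxz : ∀ ζ, |kerCov G r β c₀ b₀ ζ (dens G r x) (dens G r z)| ≤ cc)
    (hcxy : ∀ ζ, |kerCov G r β c₀ b₀ ζ (dens G r x) (dens G r y)| ≤ cc)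
    (hfl : ∀ ζ, fl ≤ σ * kerK3 G r β c₀ b₀ ζ x y z) :
    fl - 6 * h₀ * cc - 8 * h₀ ^ 3 ≤ σ * kerK3 G r β c b η x y z := by
  haveI := r.secondCountableTopology
  haveI := isProbabilityMeasure_ymSpecification r.ρ r.continuous β (cubeEdges c b) η
  obtain ⟨M, hM0, hM⟩ := exists_abs_dens_le G r
  -- the seven observables, their continuity and bounds
  have hc1 : ∀ u : Fin 4 → ℤ, Continuous (dens G r u) := fun u => continuous_dens r u
  have hc2 : ∀ u u' : Fin 4 → ℤ, Continuous fun U => dens G r u U * dens G r u' U :=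
    fun u u' => (hc1 u).mul (hc1 u')
  have hc3 : Continuous fun U => dens G r x U * dens G r y U * dens G r z U := ((hc1 x).mul (hc1 y)).mul (hc1 z)
  have hb2 : ∀ u u' : Fin 4 → ℤ, ∀ U, |dens G r u U * dens G r u' U| ≤ M * M := fun u u' U => by
    rw [abs_mul]; exact mul_le_mul (hM u U) (hM u' U) (abs_nonneg _) hM0
  have hb3 : ∀ U, |dens G r x U * dens G r y U * dens G r z U| ≤ M * M * M := fun U => by
    rw [abs_mul]; exact mul_le_mul (hb2 x y U) (hM z U) (abs_nonneg _) (mul_nonneg hM0 hM0)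
  -- the seven `Q₀`-kernel means as continuous functions of the exterior
  have hk1 : ∀ u : Fin 4 → ℤ, Continuous fun ζ => kerE G r β c₀ b₀ ζ (dens G r u) := fun u => by
    unfold kerE; exact continuous_integral_ymSpecification r.ρ r.continuous β _ (hc1 u) (hM u)
  have hk2 : ∀ u u' : Fin 4 → ℤ, Continuous fun ζ => kerE G r β c₀ b₀ ζ (fun U => dens G r u U * dens G r u' U) :=
    fun u u' => by
    unfold kerE; exact continuous_integral_ymSpecification r.ρ r.continuous β _ (hc2 u u') (hb2 u u')
  have hk3 : Continuous fun ζ => kerE G r β c₀ b₀ ζ (fun U => dens G r x U * dens G r y U * dens G r z U) := by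
    unfold kerE; exact continuous_integral_ymSpecification r.ρ r.continuous β _ hc3 hb3
  -- consistency: the `Q`-kernel means are `Q`-means of the `Q₀`-kernel means
  have hE1 : ∀ u : Fin 4 → ℤ, kerE G r β c b η (dens G r u) =
      kerE G r β c b η (fun ζ => kerE G r β c₀ b₀ ζ (dens G r u)) := fun u =>
    (kerE_kerE_of_subset G r β hsub η (hc1 u).measurable (hM u)).symm
  have hE2 : ∀ u u' : Fin 4 → ℤ, kerE G r β c b η (fun U => dens G r u U * dens G r u' U) =
      kerE G r β c b η (fun ζ => kerE G r β c₀ b₀ ζ (fun U => dens G r u U * dens G r u' U)) := fun u u' =>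
    (kerE_kerE_of_subset G r β hsub η (hc2 u u').measurable (hb2 u u')).symm
  have hE3 : kerE G r β c b η (fun U => dens G r x U * dens G r y U * dens G r z U) =
      kerE G r β c b η (fun ζ => kerE G r β c₀ b₀ ζ (fun U => dens G r x U * dens G r y U * dens G r z U)) :=
    (kerE_kerE_of_subset G r β hsub η hc3.measurable hb3).symm
  have key := cumulant3_lower_of_kernel (μ := ymSpecification (d := 4) r.ρ β (cubeEdges c b) η)
    (F₁ := fun ζ => kerE G r β c₀ b₀ ζ (dens G r x)) (F₂ := fun ζ => kerE G r β c₀ b₀ ζ (dens G r y))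
    (F₃ := fun ζ => kerE G r β c₀ b₀ ζ (dens G r z))
    (F₁₂ := fun ζ => kerE G r β c₀ b₀ ζ (fun U => dens G r x U * dens G r y U))
    (F₁₃ := fun ζ => kerE G r β c₀ b₀ ζ (fun U => dens G r x U * dens G r z U))
    (F₂₃ := fun ζ => kerE G r β c₀ b₀ ζ (fun U => dens G r y U * dens G r z U))
    (F₁₂₃ := fun ζ => kerE G r β c₀ b₀ ζ (fun U => dens G r x U * dens G r y U * dens G r z U))
    (hk1 x) (hk1 y) (hk1 z) (hk2 x y) (hk2 x z) (hk2 y z) hk3 hσ hdx hdy hdz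
    (fun ζ => by simpa only [kerCov] using hcyz ζ) (fun ζ => by simpa only [kerCov] using hcxz ζ)
    (fun ζ => by simpa only [kerCov] using hcxy ζ) (fun ζ => by simpa only [kerK3] using hfl ζ)
  unfold kerK3
  rw [hE3, hE1 x, hE1 y, hE1 z, hE2 y z, hE2 x z, hE2 x y]
  simpa only [kerE] using key

end Kernel

/-! ## §2 Collar lemmas for a general exponent -/

section Collar

/-- **Absorption.**  If `κ ≥ (max 0 (B / (c Γs)))^{1/k}` (`k ≠ 0`, `c, Γs > 0`) then
`B ≤ c · Γs · (1 + κ)^k`, i.e. `B / (1+κ)^k ≤ c Γs`. [folklore] -/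
theorem le_mul_one_add_collar_pow {B c Γs κ : ℝ} {k : ℕ} (hk : k ≠ 0) (hc : 0 < c) (hΓ : 0 < Γs)
    (hκ : (max 0 (B / (c * Γs))) ^ ((k : ℝ)⁻¹) ≤ κ) : B ≤ c * Γs * (1 + κ) ^ k := by
  set A : ℝ := max 0 (B / (c * Γs)) with hA
  have hA0 : 0 ≤ A := le_max_left _ _
  have hr0 : 0 ≤ A ^ ((k : ℝ)⁻¹) := Real.rpow_nonneg hA0 _
  have hrk : (A ^ ((k : ℝ)⁻¹)) ^ k = A := Real.rpow_inv_natCast_pow hA0 hk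
  have h1 : A ≤ (1 + κ) ^ k := by
    calc A = (A ^ ((k : ℝ)⁻¹)) ^ k := hrk.symm
      _ ≤ (1 + κ) ^ k := pow_le_pow_left₀ hr0 (by linarith) k
  have h2 : B / (c * Γs) ≤ A := le_max_right _ _
  have hcΓ : 0 < c * Γs := mul_pos hc hΓ
  calc B = c * Γs * (B / (c * Γs)) := by field_simp
    _ ≤ c * Γs * A := mul_le_mul_of_nonneg_left h2 hcΓ.le
    _ ≤ c * Γs * (1 + κ) ^ k := mul_le_mul_of_nonneg_left h1 hcΓ.le

/-- **Growth makes the collar admissible (general exponent).**  If `Γ(s)/s^k → ∞` as `s → 0⁺` (`k ≠ 0`) then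
`s · (max 0 (A / Γ(s ∧ ℓ)))^{1/k} → 0` (`A ≥ 0`, `ℓ > 0`): for small `s` it equals `(A / (Γ(s)/s^k))^{1/k}`.
[folklore] -/
theorem tendsto_mul_collar_rpow {Γ : ℝ → ℝ} {A ℓ : ℝ} {k : ℕ} (hk : k ≠ 0) (hA : 0 ≤ A) (hℓ : 0 < ℓ)
    (hΓlim : Tendsto (fun s : ℝ => Γ s / s ^ k) (nhdsWithin 0 (Set.Ioi 0)) atTop) :
    Tendsto (fun s : ℝ => s * (max 0 (A / Γ (min s ℓ))) ^ ((k : ℝ)⁻¹))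
      (nhdsWithin 0 (Set.Ioi 0)) (nhds 0) := by
  have hkpos : (0 : ℝ) < (k : ℝ)⁻¹ := by
    have : (0 : ℝ) < k := by exact_mod_cast Nat.pos_of_ne_zero hk
    positivity
  have hg : Tendsto (fun s : ℝ => A * (Γ s / s ^ k)⁻¹) (nhdsWithin 0 (Set.Ioi 0)) (nhds 0) := by
    have := (tendsto_inv_atTop_zero.comp hΓlim).const_mul A
    simpa using this
  have hroot : Tendsto (fun u : ℝ => u ^ ((k : ℝ)⁻¹)) (nhds 0) (nhds 0) := by
    have hc := (Real.continuousAt_rpow_const 0 ((k : ℝ)⁻¹) (Or.inr hkpos.le)).tendsto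
    rwa [Real.zero_rpow hkpos.ne'] at hc
  have hcomp := hroot.comp hg
  have hev1 : ∀ᶠ s in nhdsWithin (0 : ℝ) (Set.Ioi 0), 1 ≤ Γ s / s ^ k := hΓlim.eventually_ge_atTop 1
  have hev2 : ∀ᶠ s in nhdsWithin (0 : ℝ) (Set.Ioi 0), s ∈ Set.Ioi (0 : ℝ) := self_mem_nhdsWithin
  have hev3 : ∀ᶠ s in nhdsWithin (0 : ℝ) (Set.Ioi 0), s < ℓ := mem_nhdsWithin_of_mem_nhds (Iio_mem_nhds hℓ)
  refine hcomp.congr' ?_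
  filter_upwards [hev1, hev2, hev3] with s h1 h2 h3
  have hs : 0 < s := h2
  have hsk : 0 < s ^ k := by positivity
  have hΓs : 0 < Γ s := by
    have : 0 < Γ s / s ^ k := lt_of_lt_of_le one_pos h1
    exact (div_pos_iff_of_pos_right hsk).1 this
  have hmin : min s ℓ = s := min_eq_left h3.le
  have hmax : max 0 (A / Γ s) = A / Γ s := max_eq_right (div_nonneg hA hΓs.le)
  simp only [Function.comp_apply]
  rw [hmin, hmax]
  have hsroot : (s ^ k) ^ ((k : ℝ)⁻¹) = s := Real.pow_rpow_inv_natCast hs.le hk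
  rw [show (A * (Γ s / s ^ k)⁻¹) = s ^ k * (A / Γ s) by field_simp,
    Real.mul_rpow hsk.le (div_nonneg hA hΓs.le), hsroot]

/-- **The collar is antitone** when `Γ` is positive and monotone on `(0, ℓ]` (`A ≥ 0`, exponent `e ≥ 0`). [folklore] -/
theorem antitoneOn_collar_rpow {Γ : ℝ → ℝ} {A ℓ e : ℝ} (he : 0 ≤ e) (hA : 0 ≤ A) (hℓ : 0 < ℓ)
    (hΓpos : ∀ s : ℝ, 0 < s → s ≤ ℓ → 0 < Γ s) (hΓmono : MonotoneOn Γ (Set.Ioc 0 ℓ)) :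
    AntitoneOn (fun s : ℝ => (max 0 (A / Γ (min s ℓ))) ^ e) (Set.Ioi 0) := by
  intro s hs t ht hst
  have hs' : 0 < s := hs
  have ht' : 0 < t := ht
  have hms : min s ℓ ∈ Set.Ioc 0 ℓ := ⟨lt_min hs' hℓ, min_le_right _ _⟩
  have hmt : min t ℓ ∈ Set.Ioc 0 ℓ := ⟨lt_min ht' hℓ, min_le_right _ _⟩
  have hle : Γ (min s ℓ) ≤ Γ (min t ℓ) := hΓmono hms hmt (min_le_min hst le_rfl)
  have hps : 0 < Γ (min s ℓ) := hΓpos _ hms.1 hms.2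
  have hdiv : A / Γ (min t ℓ) ≤ A / Γ (min s ℓ) := div_le_div_of_nonneg_left hA hps hle
  exact Real.rpow_le_rpow (le_max_left _ _) (max_le_max le_rfl hdiv) he

/-- Growth at exponent `k` gives growth at every larger exponent `m ≥ k` (near `0⁺`, `s^m ≤ s^k`). [folklore] -/
theorem tendsto_div_pow_atTop_of_le {Γ : ℝ → ℝ} {k m : ℕ} (hkm : k ≤ m)
    (hΓlim : Tendsto (fun s : ℝ => Γ s / s ^ k) (nhdsWithin 0 (Set.Ioi 0)) atTop) :
    Tendsto (fun s : ℝ => Γ s / s ^ m) (nhdsWithin 0 (Set.Ioi 0)) atTop := by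
  have hev1 : ∀ᶠ s in nhdsWithin (0 : ℝ) (Set.Ioi 0), 0 ≤ Γ s / s ^ k := hΓlim.eventually_ge_atTop 0
  have hev2 : ∀ᶠ s in nhdsWithin (0 : ℝ) (Set.Ioi 0), s ∈ Set.Ioi (0 : ℝ) := self_mem_nhdsWithin
  have hev3 : ∀ᶠ s in nhdsWithin (0 : ℝ) (Set.Ioi 0), s < 1 := mem_nhdsWithin_of_mem_nhds (Iio_mem_nhds one_pos)
  refine tendsto_atTop_mono' _ ?_ hΓlim
  filter_upwards [hev1, hev2, hev3] with s h1 h2 h3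
  have hs : 0 < s := h2
  have hsk : 0 < s ^ k := by positivity
  have hsm : 0 < s ^ m := by positivity
  have hΓ0 : 0 ≤ Γ s := by
    have := mul_nonneg h1 hsk.le
    rwa [div_mul_cancel₀ _ hsk.ne'] at this
  have hpow : s ^ m ≤ s ^ k := pow_le_pow_of_le_one hs.le h3.le hkm
  exact div_le_div_of_nonneg_left hΓ0 hsm hpow

end Collar

/-! ## §3 Triangle geometry -/

section Geometry

/-- A vector within `t · n` of `n • u` (`n ≥ 0`) has norm between `(‖u‖ − t) n` and `(‖u‖ + t) n`. [folklore] -/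
theorem norm_bounds_of_near {E : Type*} [SeminormedAddCommGroup E] [NormedSpace ℝ E] {a u : E} {t n : ℝ}
    (hn : 0 ≤ n) (h : ‖a - n • u‖ ≤ t * n) : (‖u‖ - t) * n ≤ ‖a‖ ∧ ‖a‖ ≤ (‖u‖ + t) * n := by
  have hnu : ‖n • u‖ = n * ‖u‖ := by rw [norm_smul, Real.norm_of_nonneg hn]
  constructor
  · have h1 : ‖n • u‖ - ‖a - n • u‖ ≤ ‖a‖ := by
      have := norm_sub_norm_le (n • u) (n • u - a)
      rw [sub_sub_cancel, norm_sub_rev] at this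
      linarith
    rw [hnu] at h1
    nlinarith
  · have h1 : ‖a‖ ≤ ‖a - n • u‖ + ‖n • u‖ := by
      have := norm_add_le (a - n • u) (n • u)
      rwa [sub_add_cancel] at this
    rw [hnu] at h1
    nlinarith

/-- The third side of the reference triangle: if `y − x ≈ n v` and `z − x ≈ n w` up to `δ n` each, then `z − y` is within
`2 δ n` of `n (w − v)`. [folklore] -/
theorem norm_third_side_near {x y z : Fin 4 → ℤ} {v w : EuclideanSpace ℝ (Fin 4)} {δ : ℝ} {n : ℝ}
    (hy : ‖siteToE (y - x) - n • v‖ ≤ δ * n) (hz : ‖siteToE (z - x) - n • w‖ ≤ δ * n) :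
    ‖siteToE (z - y) - n • (w - v)‖ ≤ 2 * δ * n := by
  have hsplit : siteToE (z - y) - n • (w - v) = (siteToE (z - x) - n • w) - (siteToE (y - x) - n • v) := by
    have : z - y = (z - x) - (y - x) := by abel
    rw [this, siteToE_sub, smul_sub]
    abel
  rw [hsplit]
  calc ‖(siteToE (z - x) - n • w) - (siteToE (y - x) - n • v)‖
      ≤ ‖siteToE (z - x) - n • w‖ + ‖siteToE (y - x) - n • v‖ := norm_sub_le _ _
    _ ≤ δ * n + δ * n := add_le_add hz hy
    _ = 2 * δ * n := by ring

end Geometry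

end Summit.QuantumFields.YangMills.Cruxes.NT.WeakPackage

end
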